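import Summits.Ventures.HSemireg.ContractionSpanAlgebra
import Mathlib.LinearAlgebra.CliffordAlgebra.Conjugation
import Mathlib.LinearAlgebra.CliffordAlgebra.Fold
import Mathlib.LinearAlgebra.Dual.Defs
import Mathlib.LinearAlgebra.Dimension.Basic
import HarnessLib

/-!
# Venture HSemireg — the class-level FOURIER (Mukai / Poincaré) DUALITY `Λ(V^*) → Λ V`, `ξ ↦ ξ ⌟ ω`,
# swaps wedge and interior product and PRESERVES the polyvector contraction rank («FM-INV» at class level)

HONEST FRAMING. Pure linear algebra in exterior algebras, written for the computation cell `pub-hsemireg`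
(seat p6, «Mukai-transform facts used by the amplification chain») over seat p4's abstract contraction span
`ContractionSpan.span L Θ x` (`ContractionSpanAlgebra.lean`). Nothing here is a claim about any variety; no
Fourier–Mukai FUNCTOR is constructed; nothing here says that HC / HC_CM / HC_AV holds. Everything is PROVED; no named
fact. Two definitions (`pairAct`, `pairDual`, with bodies).

THE STEP SERVED. th-7's dictionary (`theory/FORMULA-N-th7.md` §N.5, §A.4; STRUCTURE.md §2 (S1) «the position of ker is
FRAME-DEPENDENT (FM / twist move it)», «the census' 18 at n = 2 is the box route N.2 + N.3 (+ FM-INV on paper)») moves the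
contraction rank `r = rank(ξ ↦ ξ ⌟ ch)` between an abelian variety `X` and its dual `X̂` along the Fourier–Mukai
transform: `H¹(X̂) = H¹(X)^*`, `H^{0,1}(X̂) = H⁰(X, T_X) = (H^{0,1}(X))^⊥`, `H⁰(X̂, T) = H^{0,1}(X)`, and on classes
`ch(Φ E) = F(ch E)` with `F : Λ H¹(X) → Λ H¹(X̂)` the cohomological transform [Lange 2023 §6.2.4; Mukai 1987; Beauville 1983
— BY NAME, not typed].
So far «`r` is FM-invariant» was ON PAPER. This file proves the exterior-algebra statement behind it, for ANY
commutative ring `K`, `K`-modules `M, N` and pairing `φ : M → N^*`: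
* §1 `pairAct φ : Λ M →ₐ End(Λ N)`, `m ↦ ι_{φ m}` (universal property: `ι_{φ m}² = 0`), and the duality map
  `pairDual φ ω : Λ M → Λ N`, `ξ ↦ (pairAct φ ξ) ω` («`ξ ⌟ ω`»); `pairDual_ι_mul`: `D(m ∧ ξ) = ι_{φ m} D(ξ)` (exact).
* §2 KEY LEMMA `pairAct_contractLeft_flip` (left induction, CAR only): `pairAct φ (ι_{φ♭ n} ξ) y =
  n ∧ pairAct φ ξ y − pairAct φ (ξ̃)(n ∧ y)` (`ξ̃` = grade involution, Mathlib `CliffordAlgebra.involute`); hence for a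
  TOP form `ω` (`n ∧ ω = 0` for all `n`) `pairDual_contractLeft_flip`: `D(ι_{φ♭ n} ξ) = n ∧ D(ξ)` — EXACT, no signs.
* §3 TRANSPORT `map_pairDual_span`: `D` maps the contraction span of `ξ` for the data (vectors `Θ' ⊆ M`, forms
  `φ♭(L)`) ONTO the contraction span of `D ξ` for the data (vectors `L ⊆ N`, forms `φ(Θ')`), whenever `φ(Θ')` kills `L`
  (the mixed generators pick up a sign, absorbed by the span).
* §4 For a vector space with its double dual: `D = pairDual id ω : Λ(V^*) → Λ V` and `E = pairDual eval ω' : Λ V → Λ(V^*)`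
  satisfy `E ∘ D = c • id` with `E ω = c·1` (`pairDual_eval_comp_id`), and THE RANK THEOREM `rank_span_pairDual_eq`:
  if `c` is a unit, `rank span_V L Θ (D ξ) = rank span_{V^*} Θ (eval L) ξ` — the contraction rank is invariant under the
  Fourier duality with the roles `(H^{0,1}, H⁰(T))` SWAPPED, for every `ξ` (all degrees mixed, any characteristic).
  The non-vanishing of `c` for a basis volume pair (`c = ±1`) and the real-carrier corollary are the sequel's.
References: [BourbakiAlgebre1a3] Ch. III §7 no. 1, §11 no. 9 (interior products `i(x)`, antiderivations), §11 no. 11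
Prop. 12 (`φ_p : ⋀ᵖ M ≅ ⋀^{n-p} M^*`, `x ↦ i(x) e^*`); [Mukai1981] Thm. 2.2 (the functor is an equivalence; the
class-level map is its shadow); [Lange2023AbelianVarietiesComplex] §6.2.4 (Poincaré duality / the cohomological transform
in `⋀^• H¹`);
[BuchweitzFlenner2008HH] Prop. 6.4.4 (why contraction spans).
-/

noncomputable section

open CliffordAlgebra (contractLeft)
open ExteriorAlgebra (ι)
open Module

namespace Summit.Ventures.HSemireg

namespace ContractionSpan

section Ring
variable (K : Type*) [CommRing K] {M N : Type*} [AddCommGroup M] [Module K M] [AddCommGroup N] [Module K N]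

/-! ### 1. The contraction action of `Λ M` on `Λ N` along a pairing `φ : M → N^*`, and the duality map -/

/-- **The contraction action along a pairing** `φ : M → N^*`: the algebra map `Λ M → End(Λ N)` with
`m ↦ ι_{φ m}` (interior product, Mathlib's `CliffordAlgebra.contractLeft`), well defined since `ι_{φ m} ∘ ι_{φ m} = 0`.
For `M = N^*`, `φ = id` this is `θ₁ ∧ ⋯ ∧ θ_k ↦ i(θ₁) ∘ ⋯ ∘ i(θ_k)`.
[cite: BourbakiAlgebre1a3, Ch. III §11 no. 9] -/
def pairAct (φ : M →ₗ[K] Module.Dual K N) : ExteriorAlgebra K M →ₐ[K] Module.End K (ExteriorAlgebra K N) :=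
  ExteriorAlgebra.lift K ⟨(CliffordAlgebra.contractLeft (Q := (0 : QuadraticForm K N))).comp φ, fun m =>
    LinearMap.ext fun x => by
      simp only [LinearMap.coe_comp, Function.comp_apply, Module.End.mul_apply, LinearMap.zero_apply]
      exact CliffordAlgebra.contractLeft_contractLeft _ _⟩

/-- **The duality map `D_ω = pairDual φ ω : Λ M → Λ N`, `ξ ↦ (pairAct φ ξ) ω`** («`ξ ⌟ ω`»; for `M = N^*`, `φ = id`
and `ω` a volume form this is Bourbaki's `φ : ⋀ M^* ≅ ⋀ M`, the class-level Fourier / Poincaré duality).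
[cite: BourbakiAlgebre1a3, Ch. III §11 no. 11 Prop. 12] -/
def pairDual (φ : M →ₗ[K] Module.Dual K N) (ω : ExteriorAlgebra K N) : ExteriorAlgebra K M →ₗ[K] ExteriorAlgebra K N :=
  (pairAct K φ).toLinearMap.flip ω

variable {K}

/-- `pairAct φ (m) = ι_{φ m}`. [cite: BourbakiAlgebre1a3, Ch. III §11 no. 9] -/
theorem pairAct_ι (φ : M →ₗ[K] Module.Dual K N) (m : M) : pairAct K φ (ι K m) = contractLeft (φ m) := by
  rw [pairAct, ExteriorAlgebra.lift_ι_apply]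
  rfl

/-- `pairAct φ (r·1) y = r·y`. [cite: BourbakiAlgebre1a3, Ch. III §11 no. 9] -/
theorem pairAct_algebraMap_apply (φ : M →ₗ[K] Module.Dual K N) (r : K) (y : ExteriorAlgebra K N) :
    pairAct K φ (algebraMap K _ r) y = r • y := by
  rw [AlgHom.commutes, Module.algebraMap_end_apply]

/-- Left induction on the exterior algebra (Mathlib's `CliffordAlgebra.left_induction` at `Q = 0`).
[cite: BourbakiAlgebre1a3, Ch. III §7 no. 1] -/
theorem left_induction' {P : ExteriorAlgebra K M → Prop} (h0 : ∀ r : K, P (algebraMap K _ r))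
    (hadd : ∀ x y, P x → P y → P (x + y)) (hmul : ∀ x m, P x → P (ι K m * x)) (x : ExteriorAlgebra K M) : P x :=
  CliffordAlgebra.left_induction _ h0 hadd hmul x

/-- The grade involution negates generators: `ι̃ m = -ι m` (Mathlib's `CliffordAlgebra.involute_ι`, in the
`ExteriorAlgebra.ι` spelling). [cite: BourbakiAlgebre1a3, Ch. III §7 no. 1] -/
theorem involute_ι' (m : M) : CliffordAlgebra.involute (ι K m) = -ι K m :=
  CliffordAlgebra.involute_ι m

/-! ### 2. KEY LEMMA: contraction on the `M`-side is the graded commutator with wedge on the `N`-side -/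

/-- **KEY LEMMA.** For `n ∈ N` and the form `φ♭ n = (m ↦ φ m n)` on `M`:
`pairAct φ (ι_{φ♭ n} ξ) y = n ∧ pairAct φ ξ y − pairAct φ (ξ̃) (n ∧ y)` (graded commutator; left induction on `ξ`
with the CAR relation `ι_θ(v ∧ z) = θ(v) z − v ∧ ι_θ z` only). [cite: BourbakiAlgebre1a3, Ch. III §11 no. 9] -/
theorem pairAct_contractLeft_flip (φ : M →ₗ[K] Module.Dual K N) (n : N) (ξ : ExteriorAlgebra K M)
    (y : ExteriorAlgebra K N) :
    pairAct K φ (contractLeft (φ.flip n) ξ) y =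
      ι K n * pairAct K φ ξ y - pairAct K φ (CliffordAlgebra.involute ξ) (ι K n * y) := by
  induction ξ using left_induction' generalizing y with
  | h0 r =>
    rw [CliffordAlgebra.contractLeft_algebraMap, map_zero, LinearMap.zero_apply, pairAct_algebraMap_apply,
      AlgHom.commutes, pairAct_algebraMap_apply, mul_smul_comm, sub_self]
  | hadd x x' hx hx' =>
    simp only [map_add, LinearMap.add_apply, hx, hx', mul_add]
    abel
  | hmul x m hx =>
    simp only [CliffordAlgebra.contractLeft_ι_mul, map_sub, map_smul, map_mul, map_neg, LinearMap.sub_apply,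
      LinearMap.smul_apply, LinearMap.neg_apply, LinearMap.flip_apply, Module.End.mul_apply, pairAct_ι, involute_ι',
      neg_mul, hx]
    abel

/-- `D_ω ξ = (pairAct φ ξ) ω`. [cite: BourbakiAlgebre1a3, Ch. III §11 no. 11] -/
theorem pairDual_apply (φ : M →ₗ[K] Module.Dual K N) (ω : ExteriorAlgebra K N) (ξ : ExteriorAlgebra K M) :
    pairDual K φ ω ξ = pairAct K φ ξ ω := rfl

/-- `D_ω 1 = ω`. [cite: BourbakiAlgebre1a3, Ch. III §11 no. 11] -/
theorem pairDual_one (φ : M →ₗ[K] Module.Dual K N) (ω : ExteriorAlgebra K N) : pairDual K φ ω 1 = ω := by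
  rw [pairDual_apply, map_one, Module.End.one_apply]

/-- `D_ω (r·1) = r·ω`. [cite: BourbakiAlgebre1a3, Ch. III §11 no. 11] -/
theorem pairDual_algebraMap (φ : M →ₗ[K] Module.Dual K N) (ω : ExteriorAlgebra K N) (r : K) :
    pairDual K φ ω (algebraMap K _ r) = r • ω := by
  rw [pairDual_apply, pairAct_algebraMap_apply]

/-- **Wedge ↦ interior product**: `D_ω (m ∧ ξ) = ι_{φ m} D_ω(ξ)` (exact). [cite: BourbakiAlgebre1a3, Ch. III §11 no. 11] -/
theorem pairDual_ι_mul (φ : M →ₗ[K] Module.Dual K N) (ω : ExteriorAlgebra K N) (m : M) (ξ : ExteriorAlgebra K M) :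
    pairDual K φ ω (ι K m * ξ) = contractLeft (φ m) (pairDual K φ ω ξ) := by
  rw [pairDual_apply, pairDual_apply, map_mul, Module.End.mul_apply, pairAct_ι]

/-- **Interior product ↦ wedge**: for a TOP form `ω` (`n ∧ ω = 0` for all `n`), `D_ω (ι_{φ♭ n} ξ) = n ∧ D_ω(ξ)` —
EXACT, for every (inhomogeneous) `ξ`. [cite: BourbakiAlgebre1a3, Ch. III §11 no. 11 Prop. 12] -/
theorem pairDual_contractLeft_flip (φ : M →ₗ[K] Module.Dual K N) {ω : ExteriorAlgebra K N}
    (hω : ∀ v : N, ι K v * ω = 0) (n : N) (ξ : ExteriorAlgebra K M) :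
    pairDual K φ ω (contractLeft (φ.flip n) ξ) = ι K n * pairDual K φ ω ξ := by
  rw [pairDual_apply, pairDual_apply, pairAct_contractLeft_flip, hω n, map_zero, sub_zero]

/-! ### 3. Transport of the contraction span along the duality map -/

/-- **TRANSPORT.** For a top form `ω`, vectors `Θ' ⊆ M`, `L ⊆ N` with `φ(Θ')` killing `L`:
`D_ω (span_M Θ' (φ♭ L) ξ) = span_N L (φ Θ') (D_ω ξ)` — the three generator families go to the three families with the
roles of wedge and interior product exchanged (`θ₁∧θ₂∧ξ ↦ ι ι Dξ`, `θ ∧ ι_{q♭} ξ ↦ -q ∧ ι_{φθ} Dξ`, `ι ι ξ ↦ q₁∧q₂∧Dξ`).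
[cite: BourbakiAlgebre1a3, Ch. III §11 no. 11 Prop. 12] [cite: BuchweitzFlenner2008HH, Prop. 6.4.4] -/
theorem map_pairDual_span (φ : M →ₗ[K] Module.Dual K N) {ω : ExteriorAlgebra K N} (hω : ∀ v : N, ι K v * ω = 0)
    {Θ' : Set M} {L : Set N} (hkill : ∀ θ ∈ Θ', ∀ q ∈ L, φ θ q = 0) (ξ : ExteriorAlgebra K M) :
    (span Θ' (φ.flip '' L) ξ).map (pairDual K φ ω) = span L (φ '' Θ') (pairDual K φ ω ξ) := by
  have hmixed : ∀ θ ∈ Θ', ∀ q ∈ L, pairDual K φ ω (ι K θ * contractLeft (φ.flip q) ξ) =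
      -(ι K q * contractLeft (φ θ) (pairDual K φ ω ξ)) := fun θ hθ q hq => by
    rw [pairDual_ι_mul, pairDual_contractLeft_flip φ hω, CliffordAlgebra.contractLeft_ι_mul, hkill θ hθ q hq, zero_smul,
      zero_sub]
  apply le_antisymm
  · rw [Submodule.map_le_iff_le_comap]
    refine Submodule.span_le.mpr ?_
    rintro y ((⟨θ₁, h₁, θ₂, h₂, rfl⟩ | ⟨θ, hθ, _, ⟨q, hq, rfl⟩, rfl⟩) | ⟨_, ⟨q₁, hq₁, rfl⟩, _, ⟨q₂, hq₂, rfl⟩, rfl⟩)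
    · rw [SetLike.mem_coe, Submodule.mem_comap, pairDual_ι_mul, pairDual_ι_mul]
      exact Submodule.subset_span (Or.inr ⟨φ θ₁, ⟨θ₁, h₁, rfl⟩, φ θ₂, ⟨θ₂, h₂, rfl⟩, rfl⟩)
    · rw [SetLike.mem_coe, Submodule.mem_comap, hmixed θ hθ q hq]
      exact Submodule.neg_mem _ (Submodule.subset_span (Or.inl (Or.inr ⟨q, hq, φ θ, ⟨θ, hθ, rfl⟩, rfl⟩)))
    · rw [SetLike.mem_coe, Submodule.mem_comap, pairDual_contractLeft_flip φ hω, pairDual_contractLeft_flip φ hω]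
      exact Submodule.subset_span (Or.inl (Or.inl ⟨q₁, hq₁, q₂, hq₂, rfl⟩))
  · refine Submodule.span_le.mpr ?_
    rintro y ((⟨q₁, hq₁, q₂, hq₂, rfl⟩ | ⟨q, hq, _, ⟨θ, hθ, rfl⟩, rfl⟩) | ⟨_, ⟨θ₁, h₁, rfl⟩, _, ⟨θ₂, h₂, rfl⟩, rfl⟩)
    · refine ⟨contractLeft (φ.flip q₁) (contractLeft (φ.flip q₂) ξ),
        Submodule.subset_span (Or.inr ⟨φ.flip q₁, ⟨q₁, hq₁, rfl⟩, φ.flip q₂, ⟨q₂, hq₂, rfl⟩, rfl⟩), ?_⟩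
      rw [pairDual_contractLeft_flip φ hω, pairDual_contractLeft_flip φ hω]
    · have h : -(ι K θ * contractLeft (φ.flip q) ξ) ∈ span Θ' (φ.flip '' L) ξ :=
        Submodule.neg_mem _ (Submodule.subset_span (Or.inl (Or.inr ⟨θ, hθ, φ.flip q, ⟨q, hq, rfl⟩, rfl⟩)))
      exact ⟨_, h, by rw [map_neg, hmixed θ hθ q hq, neg_neg]⟩
    · exact ⟨ι K θ₁ * (ι K θ₂ * ξ), Submodule.subset_span (Or.inl (Or.inl ⟨θ₁, h₁, θ₂, h₂, rfl⟩)),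
        by rw [pairDual_ι_mul, pairDual_ι_mul]⟩

/-- Scaling the class by a unit does not change the contraction span. [folklore] -/
theorem span_smul_of_isUnit (L : Set N) (Θ : Set (Module.Dual K N)) {c : K} (hc : IsUnit c) (x : ExteriorAlgebra K N) :
    span L Θ (c • x) = span L Θ x := by
  have hle : ∀ (a : K) (z : ExteriorAlgebra K N), span L Θ (a • z) ≤ span L Θ z := fun a z => by
    refine Submodule.span_le.mpr ?_
    rintro y ((⟨q₁, hq₁, q₂, hq₂, rfl⟩ | ⟨q, hq, θ, hθ, rfl⟩) | ⟨θ₁, h₁, θ₂, h₂, rfl⟩)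
    · rw [mul_smul_comm, mul_smul_comm]
      exact Submodule.smul_mem _ a (Submodule.subset_span (Or.inl (Or.inl ⟨q₁, hq₁, q₂, hq₂, rfl⟩)))
    · rw [map_smul, mul_smul_comm]
      exact Submodule.smul_mem _ a (Submodule.subset_span (Or.inl (Or.inr ⟨q, hq, θ, hθ, rfl⟩)))
    · rw [map_smul, map_smul]
      exact Submodule.smul_mem _ a (Submodule.subset_span (Or.inr ⟨θ₁, h₁, θ₂, h₂, rfl⟩))
  obtain ⟨u, rfl⟩ := hc
  refine le_antisymm (hle _ x) ?_
  have h := hle (↑u⁻¹ : K) ((u : K) • x)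
  rwa [smul_smul, Units.inv_mul, one_smul] at h

end Ring

/-! ### 4. `V`, `V^*`, `V^{**}`: the composite `E ∘ D` is a scalar, and the rank theorem -/

section Dual
variable {K : Type*} [CommRing K] {V : Type*} [AddCommGroup V] [Module K V]

/-- `id♭ = eval` (the double-dual embedding). [cite: BourbakiAlgebre1a3, Ch. II §7 no. 5] -/
theorem flip_id_eq_eval :
    (LinearMap.id : Module.Dual K V →ₗ[K] Module.Dual K V).flip = Module.Dual.eval K V := rfl

/-- `eval♭ = id`. [cite: BourbakiAlgebre1a3, Ch. II §7 no. 5] -/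
theorem flip_eval_eq_id : (Module.Dual.eval K V).flip = LinearMap.id := by
  show (LinearMap.flip (LinearMap.id : Module.Dual K V →ₗ[K] Module.Dual K V)).flip = LinearMap.id
  exact LinearMap.flip_flip _

/-- `eval♭ θ = θ`. [cite: BourbakiAlgebre1a3, Ch. II §7 no. 5] -/
theorem flip_eval_apply (θ : Module.Dual K V) : (Module.Dual.eval K V).flip θ = θ := by
  rw [flip_eval_eq_id, LinearMap.id_apply]

/-- **`E ∘ D` is a scalar**: for `D = pairDual id ω : Λ(V^*) → Λ V` (`ω` a top form of `V`) and
`E = pairDual eval ω' : Λ V → Λ(V^*)` (`ω'` a top form of `V^*`), if `E ω = c·1` then `E (D ξ) = c·ξ` for every `ξ`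
(left induction: `E D (θ ∧ ξ) = E(ι_θ Dξ) = θ ∧ E D ξ`). [cite: BourbakiAlgebre1a3, Ch. III §11 no. 11 Prop. 12] -/
theorem pairDual_eval_comp_id {ω : ExteriorAlgebra K V} {ω' : ExteriorAlgebra K (Module.Dual K V)}
    (hω' : ∀ θ : Module.Dual K V, ι K θ * ω' = 0) {c : K}
    (hc : pairDual K (Module.Dual.eval K V) ω' ω = algebraMap K _ c) (ξ : ExteriorAlgebra K (Module.Dual K V)) :
    pairDual K (Module.Dual.eval K V) ω' (pairDual K (LinearMap.id : Module.Dual K V →ₗ[K] Module.Dual K V) ω ξ) =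
      c • ξ := by
  induction ξ using left_induction' with
  | h0 r => rw [pairDual_algebraMap, map_smul, hc, Algebra.algebraMap_eq_smul_one, Algebra.algebraMap_eq_smul_one,
      smul_comm]
  | hadd x y hx hy => rw [map_add, map_add, hx, hy, smul_add]
  | hmul x θ hx =>
    rw [pairDual_ι_mul, LinearMap.id_apply, ← flip_eval_apply (K := K) θ, pairDual_contractLeft_flip _ hω',
      flip_eval_apply, hx, mul_smul_comm]

/-- **THE RANK THEOREM (class-level FM-invariance of the contraction rank).** Let `ω ∈ Λ V`, `ω' ∈ Λ(V^*)` be top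
forms whose duality maps `D = pairDual id ω`, `E = pairDual eval ω'` compose to a UNIT scalar (`E ω = c·1`, `c` a
unit — for a basis volume pair `c = ±1`, sequel). Then for vectors `L ⊆ V`, forms `Θ ⊆ V^*` killing `L`, and every
class `ξ ∈ Λ(V^*)`: `rank span_V L Θ (D ξ) = rank span_{V^*} Θ (eval L) ξ` — on the dual side the `(0,1)`-classes
`Θ = H⁰(X,T) = H^{0,1}(X̂)` act by wedge and the vectors `L = H^{0,1}(X) = H⁰(X̂,T)` by interior product. (`D` maps the
one span onto the other, `E` maps back onto the span of `c·ξ`.) [cite: BourbakiAlgebre1a3, Ch. III §11 no. 11 Prop. 12]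
[cite: Mukai1981, Thm. 2.2] [cite: BuchweitzFlenner2008HH, Prop. 6.4.4] -/
theorem rank_span_pairDual_eq {ω : ExteriorAlgebra K V} {ω' : ExteriorAlgebra K (Module.Dual K V)}
    (hω : ∀ v : V, ι K v * ω = 0) (hω' : ∀ θ : Module.Dual K V, ι K θ * ω' = 0) {c : K}
    (hc : pairDual K (Module.Dual.eval K V) ω' ω = algebraMap K _ c) (hcu : IsUnit c)
    {L : Set V} {Θ : Set (Module.Dual K V)} (hΘL : ∀ θ ∈ Θ, ∀ q ∈ L, θ q = 0)
    (ξ : ExteriorAlgebra K (Module.Dual K V)) :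
    Module.rank K (span L Θ (pairDual K (LinearMap.id : Module.Dual K V →ₗ[K] Module.Dual K V) ω ξ)) =
      Module.rank K (span Θ (Module.Dual.eval K V '' L) ξ) := by
  set D := pairDual K (LinearMap.id : Module.Dual K V →ₗ[K] Module.Dual K V) ω with hD
  set E := pairDual K (Module.Dual.eval K V) ω' with hE
  -- `D` maps the dual-side span ONTO the `V`-side span
  have h1 : (span Θ (Module.Dual.eval K V '' L) ξ).map D = span L Θ (D ξ) := by
    have h := map_pairDual_span (LinearMap.id : Module.Dual K V →ₗ[K] Module.Dual K V) hω
      (Θ' := Θ) (L := L) (fun θ hθ q hq => hΘL θ hθ q hq) ξ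
    rwa [flip_id_eq_eval, LinearMap.id_coe, Set.image_id] at h
  -- `E` maps the `V`-side span onto the dual-side span of `E D ξ = c·ξ`, i.e. back onto the original span
  have h2 : (span L Θ (D ξ)).map E = span Θ (Module.Dual.eval K V '' L) ξ := by
    have hkill : ∀ q ∈ L, ∀ θ ∈ Θ, Module.Dual.eval K V q θ = 0 := fun q hq θ hθ => hΘL θ hθ q hq
    have h := map_pairDual_span (Module.Dual.eval K V) hω' (Θ' := L) (L := Θ) hkill (D ξ)
    rw [flip_eval_eq_id, LinearMap.id_coe, Set.image_id] at h
    rw [h, hD, pairDual_eval_comp_id hω' hc, span_smul_of_isUnit _ _ hcu]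
  refine le_antisymm ?_ ?_
  · rw [← h1]; exact rank_map_le D _
  · rw [← h2]; exact rank_map_le E _

end Dual

end ContractionSpan

end Summit.Ventures.HSemireg

end
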